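import Summits.NavierStokesRegularity.NavierStokesRegularity.Theorems.WakeRatchetEternalInviscidRateConveyorFlux

/-!
# Conveyor ledger (crux `WakeRatchet.EternalInviscidRate`, ⟨stmt-NavierStokesRegularity-25646⟩) —
# `stub_noSloshing` REDUCED to a BACKSCATTER BUDGET

Helpers for the open stub `stub_noSloshing` (budget `γ = 1/6`) of the registered skeleton «conveyor ledger» (LINE g10-3, sha16 d183ebc25b56,
namespace `…Cruxes.EternalInviscidRate.FinalWakeLedger`).  MODEL lattice only (Tao 2016 §4 renormalised cascade); nothing here is a statement
about the Navier–Stokes equations, no stub is closed by name, no summit is proved by this file.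

For a uniformly bounded admissible INVISCID eternal solution `W` of a cancelling table with final tails `L` (landed `stub_tailLimit`):
* `tail_eq_integral_Iic_physFlux` — the PARTIAL total-flux identity `T_n(σ) = ∫_{(−∞,σ]} F_{n−1}` (FTC on a left half-line: `T_n' = F_{n−1}`,
  `T_n(−∞) = 0`; companion of the landed `finalTail_eq_integral_physFlux`: `L n = ∫_ℝ F_{n−1}`).
* `tail_le_finalTail_add_backscatter` — hence `T_n(σ) ≤ L n + ∫_ℝ F⁻_{n−1}` for every `σ`, where `F⁻ = max(−F, 0)` is the BACKWARD part of the
  bond flux: a tail can overshoot its final value by at most the TOTAL BACKSCATTER through the bond below it (one-way dynamics: `F⁻ = 0`, the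
  landed `noSloshing_oneway`).
* `noSloshing_of_backscatterBudget` — so the inner inequality of `NoSloshing R γ` at shell `n`, `T_n(σ) ≤ (1+ε₀)^γ·L n`, follows from the
  BACKSCATTER BUDGET `∫_ℝ F⁻_{n−1} ≤ ((1+ε₀)^γ − 1)·L n` («total backward transfer through a bond is at most `(1+ε₀)^γ − 1` times the net transfer
  through it»).  This is the exact residual content of `stub_noSloshing`; for `γ = 1/6` the instrument E-g10-2 (evidence on ⟨25646⟩) reads tail
  lifts `λ^{2.4}`–`λ^{2.9}` on the certified backscattering table `tao2rot ∈ E₂(4)` at `ε₀ = 1/16, 1/32`, i.e. a budget violated by an order of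
  magnitude — the stub as typed is presumptively false there (numerics only; no kernel refutation without an exact bounded eternal solution).
[cite: Tao2016AveragedNS, §4 Lemma 4.1 (4.8)–(4.10) with the cancellation (4.3), in the self-similar variables of §6.4]
-/

noncomputable section

set_option linter.dupNamespace false

open Filter Topology Set MeasureTheory
open Literature.Analysis.FluidPDE Literature.Analysis.FluidPDE.TaoCascade
open Summit.NavierStokesRegularity.NavierStokesRegularity.Theorems

namespace Summit.NavierStokesRegularity.NavierStokesRegularity.Cruxes.EternalInviscidRate.FinalWakeLedger

variable {ε₀ : ℝ} {α : Fin 4 → Fin 4 → Fin 4 → ℤ × ℤ × ℤ → ℝ} {W : ℤ → ℝ → Em 4}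

/-- **Partial total-flux identity.**  `T_n(σ) = ∫_{(−∞,σ]} F_{n−1}`: the tail above shell `n` at log-time `σ` is the energy transferred through
bond `n−1` up to `σ`. -/
theorem tail_eq_integral_Iic_physFlux (hε : 0 < ε₀) (hc : IsCancellingCoeff α) (hW : IsEternal ε₀ α W)
    (hU : UniformBound W) (n : ℤ) {L : ℤ → ℝ}
    (hL : ∀ n : ℤ, Tendsto (fun σ => ∑' k : ℕ, physEnergy ε₀ W (n + k) σ) atTop (𝓝 (L n))) (σ : ℝ) :
    ∑' k : ℕ, physEnergy ε₀ W (n + k) σ = ∫ s in Iic σ, physFlux ε₀ α W (n - 1) s := by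
  obtain ⟨S, -, hS⟩ := exists_peak_bound hε hU (n - 1) (hL (n - 1))
  have hint : Integrable (physFlux ε₀ α W (n - 1)) := integrable_physFlux hε hc hW hU (n - 1) hS
  have hderiv : ∀ s, HasDerivAt (fun z => ∑' k : ℕ, physEnergy ε₀ W (n + k) z) (physFlux ε₀ α W (n - 1) s) s :=
    fun s => hasDerivAt_finalTail hε hc hW hU n s
  have h := integral_Iic_of_hasDerivAt_of_tendsto (hderiv σ).continuousAt.continuousWithinAt
    (fun s _ => hderiv s) hint.integrableOn (tendsto_finalTail_atBot hε hU n)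
  rw [h, sub_zero]

/-- **A tail overshoots its final value by at most the total backscatter below it:** `T_n(σ) ≤ L n + ∫_ℝ max(−F_{n−1}, 0)`. -/
theorem tail_le_finalTail_add_backscatter (hε : 0 < ε₀) (hc : IsCancellingCoeff α) (hW : IsEternal ε₀ α W)
    (hU : UniformBound W) (n : ℤ) {L : ℤ → ℝ}
    (hL : ∀ n : ℤ, Tendsto (fun σ => ∑' k : ℕ, physEnergy ε₀ W (n + k) σ) atTop (𝓝 (L n))) (σ : ℝ) :
    ∑' k : ℕ, physEnergy ε₀ W (n + k) σ ≤ L n + ∫ s, max (-physFlux ε₀ α W (n - 1) s) 0 := by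
  obtain ⟨S, -, hS⟩ := exists_peak_bound hε hU (n - 1) (hL (n - 1))
  set F : ℝ → ℝ := physFlux ε₀ α W (n - 1) with hF
  have hint : Integrable F := integrable_physFlux hε hc hW hU (n - 1) hS
  have hpos : Integrable (fun s => max (F s) 0) := hint.pos_part
  have hneg : Integrable (fun s => max (-F s) 0) := hint.neg_part
  -- `T_n(σ) = ∫_{Iic σ} F ≤ ∫_{Iic σ} F⁺ ≤ ∫ F⁺ = ∫ F + ∫ F⁻ = L n + ∫ F⁻`
  have h1 : ∫ s in Iic σ, F s ≤ ∫ s in Iic σ, max (F s) 0 :=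
    setIntegral_mono hint.integrableOn hpos.integrableOn fun s => le_max_left _ _
  have h2 : ∫ s in Iic σ, max (F s) 0 ≤ ∫ s, max (F s) 0 :=
    setIntegral_le_integral hpos (Eventually.of_forall fun s => le_max_right _ _)
  have h3 : ∫ s, max (F s) 0 = (∫ s, F s) + ∫ s, max (-F s) 0 := by
    rw [← integral_add hint hneg]
    refine integral_congr_ae (Eventually.of_forall fun s => ?_)
    have := max_zero_sub_max_neg_zero_eq_self (F s)
    simp only
    linarith
  have hLn : L n = ∫ s, F s := by
    have h := finalTail_eq_integral_physFlux hε hc hW hU (n - 1) hL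
    rwa [sub_add_cancel] at h
  rw [tail_eq_integral_Iic_physFlux hε hc hW hU n hL σ, hLn]
  linarith

/-- **`stub_noSloshing` ⟸ BACKSCATTER BUDGET.**  If the total backward transfer through bond `n−1` is at most `((1+ε₀)^γ − 1)` times the net
transfer `L n` through it, then the tail above shell `n` never exceeds `(1+ε₀)^γ · L n` — the inner inequality of `NoSloshing R γ` at shell `n`. -/
theorem noSloshing_of_backscatterBudget (hε : 0 < ε₀) (hc : IsCancellingCoeff α) (hW : IsEternal ε₀ α W)
    (hU : UniformBound W) (n : ℤ) {L : ℤ → ℝ}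
    (hL : ∀ n : ℤ, Tendsto (fun σ => ∑' k : ℕ, physEnergy ε₀ W (n + k) σ) atTop (𝓝 (L n))) {γ : ℝ}
    (hB : ∫ s, max (-physFlux ε₀ α W (n - 1) s) 0 ≤ ((1 + ε₀) ^ γ - 1) * L n) (σ : ℝ) :
    ∑' k : ℕ, physEnergy ε₀ W (n + k) σ ≤ (1 + ε₀) ^ γ * L n := by
  have h := tail_le_finalTail_add_backscatter hε hc hW hU n hL σ
  linarith

end Summit.NavierStokesRegularity.NavierStokesRegularity.Cruxes.EternalInviscidRate.FinalWakeLedger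

end
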